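import Literature.NumberTheory.EllipticCurves.ToricTwoVariablePAdicLFunctionUpTo
import Literature.NumberTheory.GaloisRepresentations.CMTypeHeckeCharacter
import Literature.NumberTheory.Automorphic.GaloisActionPlaces
import HarnessLib

/-!
# The complex functional equation of `L(f/K, ψ, s)` READ IN DISPLAY CURRENCY: from the identity at `s = 1`
# `Γ_ℂ(b)Γ_ℂ(b+1)·L(f/K,ψ,1) = (N·D)^{a−b}·Γ_ℂ(a)Γ_ℂ(a+1)·L(f/K,ψ⁻¹,1)` to the clause
# `κ^a·V(ψ†; b, a) = κ^b·V(ψ; a, b)`, `κ = N·D/4`, `ψ† = (ψ∘g)⁻¹`, of the reflection transfer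
# (helper on the rational wall `RationalSplitIMCInclusionAtThree`, item stmt-BirchSwinnertonDyer-24207, line `ratwall_thin_comb` v8.2;
# cell `pub/bsd-wall`, LEAD `cruxlead-24207` g32; `--supports stmt-BirchSwinnertonDyer-24207`)

WHY THIS FILE. The v8.3 certificate (`…RationalSplitIMCInclusionAtThreeClosedModuloV83`, p767197) takes the complex functional equation as the
displayed hypothesis `hFE` in DISPLAY currency: `κ(N,d_K)^a · toricInterpolationValue 3 f 𝔭 𝔭′ (galConj g ψ)⁻¹ b a Ω_K (L′ 1) =
κ(N,d_K)^b · toricInterpolationValue 3 f 𝔭 𝔭′ ψ a b Ω_K (L 1)`. The printed functional equation (Jacquet 1972 Thm. 19.14 with Tate's local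
constants; Li 1979 Thm. 2.2 = Büyükboduk–Lei 2019 Thm. 2.18; typed as the named fact `jacquet1972_functionalEquation_rankinSelbergHecke_cone`,
review-queued) speaks in `Λ`-currency about `ψ` and `ψ⁻¹`. This file is the kernel glue between the two, for ANY prime `p`, level `N`, form `f`:

* §1 `rankinSelbergLocalFactorInvHecke_galConj`, **`rankinSelbergEulerProductHecke_galConj`** — the Euler product of `f` over `K` is
  INVARIANT under `ψ ↦ ψ ∘ g` (`g ∈ Aut(K/ℚ)`): the local factor of `ψ ∘ g` at `v` is the local factor of `ψ` at `g • v` (same norm,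
  `heckeValueExtZero (galConj g ψ) v = heckeValueExtZero ψ (g • v)`), and `v ↦ g • v` permutes the places; hence
  `L(f/K, (ψ∘g)⁻¹, s) = L(f/K, ψ⁻¹, s)` as Euler products (`galConj_inv`) and, by uniqueness of entire continuations on a half-plane
  (`eq_of_entire_of_eqOn_halfPlane`), as continued values at `s = 1`.
* §2 `toricEulerFactor_reflected` — `𝓔(f, (ψ∘g)⁻¹) = 𝓔(f, ψ)` when `g` SWAPS the two primes `𝔭, 𝔭′` above `p` and `ψ` is unramified there
  (`(ψ∘g)⁻¹(𝔭) = ψ(𝔭′)⁻¹`, `(ψ∘g)⁻¹(𝔭′)⁻¹ = ψ(𝔭)`).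
* §3 **`displayFE_of_lambdaFE_at_one`** — the bookkeeping `Γ_ℂ(n)Γ_ℂ(n+1) = 2^{1−2n}·Γ(n)Γ(n+1)/π^{2n+1}`: from the `Λ`-identity at `s = 1` for
  continuations `L` (of `ψ`) and `L′` (of `ψ⁻¹`), and any continuation `L″` of `(ψ∘g)⁻¹`, the display clause with **`κ = N·D/4`**
  (`D = |d_K|`; the `4^{a−b}` is `(2π)`-bookkeeping, a principal unit at `p = 3`).

Theorems only (no definition, no instance, no notation, no `sorry`); nothing about elliptic curves is proved; BSD is not proved by any of this;
24207 stays OPEN. References: [cite: Jacquet1972, §19 Thm. 19.14, Cor. 19.15] [cite: Tate1979, (3.1)] [cite: Li1979, Thm. 2.2]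
[cite: BuyukbodukLei2017, §2.4 Thm. 2.18 (arXiv:1707.00557)] [cite: CastellaWan2023, §2.4 Thm. 2.11 (arXiv:1607.02019)] [cite: Nekovar1995, (0.5), §3.4].
-/

set_option linter.dupNamespace false
set_option autoImplicit false

noncomputable section

open scoped MatrixGroups ModularForm
open CongruenceSubgroup NumberField IsDedekindDomain Field
open Literature.NumberTheory.EllipticCurves Literature.NumberTheory.GaloisRepresentations
open Literature.NumberTheory.EllipticCurves.ModularForms
open Literature.NumberTheory.Automorphic

namespace Summit.BirchSwinnertonDyer.BirchSwinnertonDyer.Theorems.UniversalToricDescentThinComb.DisplayFunctionalEquation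

variable {K : Type} [Field K] [NumberField K] {N : ℕ}

/-! ## §1 The Euler product of `f/K` is invariant under `ψ ↦ ψ ∘ g` -/

/-- `heckeValueExtZero (ψ ∘ g) v = heckeValueExtZero ψ (g • v)` (both sides vanish at ramified places, and
`(ψ∘g)(ϖ_v) = ψ(ϖ_{g v})` at unramified ones). [cite: Nekovar1995, §3.4] -/
theorem heckeValueExtZero_galConj (g : K ≃ₐ[ℚ] K) (ψ : HeckeCharacter K) (v : HeightOneSpectrum (𝓞 K)) :
    heckeValueExtZero (HeckeCharacter.galConj g ψ) v = heckeValueExtZero ψ (g • v) := by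
  by_cases h : ψ.IsUnramifiedAt (g • v)
  · rw [heckeValueExtZero_of_isUnramifiedAt ((HeckeCharacter.isUnramifiedAt_galConj_iff g ψ v).mpr h),
      heckeValueExtZero_of_isUnramifiedAt h, HeckeCharacter.valueAtUniformizer_galConj_of_isUnramifiedAt g ψ v h]
  · rw [heckeValueExtZero_of_not_isUnramifiedAt (fun h' ↦ h ((HeckeCharacter.isUnramifiedAt_galConj_iff g ψ v).mp h')),
      heckeValueExtZero_of_not_isUnramifiedAt h]

/-- The local factor of `L(f/K, ψ∘g, s)` at `v` is the local factor of `L(f/K, ψ, s)` at `g • v` (conjugate places have the same norm).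
[cite: Nekovar1995, (0.5), §3.4] -/
theorem rankinSelbergLocalFactorInvHecke_galConj (g : K ≃ₐ[ℚ] K) (f : CuspForm (Gamma0 N) 2) (ψ : HeckeCharacter K)
    (v : HeightOneSpectrum (𝓞 K)) (s : ℂ) :
    rankinSelbergLocalFactorInvHecke f (HeckeCharacter.galConj g ψ) v s =
      rankinSelbergLocalFactorInvHecke f ψ (g • v) s := by
  simp only [rankinSelbergLocalFactorInvHecke, heckeValueExtZero_galConj, HeightOneSpectrum.absNorm_algEquiv_smul]

/-- **`L(f/K, ψ ∘ g, s) = L(f/K, ψ, s)` as Euler products** (`g ∈ Aut(K/ℚ)` permutes the finite places of `K`).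
[cite: Nekovar1995, (0.5), §3.4] [cite: Jacquet1972, §19 Cor. 19.15] -/
theorem rankinSelbergEulerProductHecke_galConj (g : K ≃ₐ[ℚ] K) (f : CuspForm (Gamma0 N) 2) (ψ : HeckeCharacter K) (s : ℂ) :
    rankinSelbergEulerProductHecke f (HeckeCharacter.galConj g ψ) s = rankinSelbergEulerProductHecke f ψ s := by
  unfold rankinSelbergEulerProductHecke
  simp_rw [rankinSelbergLocalFactorInvHecke_galConj]
  exact Equiv.tprod_eq (MulAction.toPerm g) (fun w ↦ (rankinSelbergLocalFactorInvHecke f ψ w s)⁻¹)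

/-- **`L(f/K, (ψ∘g)⁻¹, s) = L(f/K, ψ⁻¹, s)` as Euler products.** [cite: Nekovar1995, (0.5), §3.4] -/
theorem rankinSelbergEulerProductHecke_galConj_inv (g : K ≃ₐ[ℚ] K) (f : CuspForm (Gamma0 N) 2) (ψ : HeckeCharacter K) (s : ℂ) :
    rankinSelbergEulerProductHecke f (HeckeCharacter.galConj g ψ)⁻¹ s = rankinSelbergEulerProductHecke f ψ⁻¹ s := by
  rw [← HeckeCharacter.galConj_inv, rankinSelbergEulerProductHecke_galConj]

omit [NumberField K] in
/-- **Uniqueness of an entire continuation from a right half-plane** `c < re s` (identity theorem; the tree's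
`eq_of_isEntireContinuation_rankinSelbergHecke` is the case `c = 3/2`). [cite: Jacquet1972, §19 Cor. 19.15 (uniqueness)] -/
theorem eq_of_entire_of_eqOn_halfPlane {c : ℝ} {F : ℂ → ℂ} {L L₁ : ℂ → ℂ} (hL : Differentiable ℂ L)
    (hL' : ∀ s : ℂ, c < s.re → L s = F s) (hL₁ : Differentiable ℂ L₁) (hL₁' : ∀ s : ℂ, c < s.re → L₁ s = F s) :
    L₁ = L := by
  refine AnalyticOnNhd.eq_of_eventuallyEq (𝕜 := ℂ) (z₀ := ((c + 1 : ℝ) : ℂ)) (fun z _ ↦ hL₁.analyticAt z)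
    (fun z _ ↦ hL.analyticAt z) ?_
  have hopen : IsOpen {s : ℂ | c < s.re} := isOpen_lt continuous_const Complex.continuous_re
  filter_upwards [hopen.mem_nhds (show c < (((c + 1 : ℝ) : ℂ)).re by rw [Complex.ofReal_re]; linarith)] with s hs
  rw [hL₁' s hs, hL' s hs]

/-- The continued value at `s = 1` of `L(f/K, (ψ∘g)⁻¹, s)` IS that of `L(f/K, ψ⁻¹, s)` (same Euler product on the half-plane, §1, and
uniqueness of the entire continuation). [cite: Jacquet1972, §19 Cor. 19.15] -/
theorem continuation_reflected_eq {c : ℝ} (g : K ≃ₐ[ℚ] K) {f : CuspForm (Gamma0 N) 2} {ψ : HeckeCharacter K} {L' L'' : ℂ → ℂ}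
    (hL' : Differentiable ℂ L') (hL'e : ∀ s : ℂ, c < s.re → L' s = rankinSelbergEulerProductHecke f ψ⁻¹ s)
    (hL'' : Differentiable ℂ L'')
    (hL''e : ∀ s : ℂ, c < s.re → L'' s = rankinSelbergEulerProductHecke f (HeckeCharacter.galConj g ψ)⁻¹ s) (s₀ : ℂ) :
    L'' s₀ = L' s₀ := by
  have h : L'' = L' := eq_of_entire_of_eqOn_halfPlane hL' hL'e hL''
    (fun s hs ↦ by rw [hL''e s hs, rankinSelbergEulerProductHecke_galConj_inv])
  rw [h]

/-! ## §2 The Euler factor at `p` is symmetric under `ψ ↦ (ψ∘g)⁻¹` when `g` swaps `𝔭` and `𝔭′` -/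

/-- **`𝓔(f, (ψ∘g)⁻¹) = 𝓔(f, ψ)`** for `g • 𝔭 = 𝔭′`, `g • 𝔭′ = 𝔭` and `ψ` unramified at `𝔭, 𝔭′`:
`toricEulerFactor p f 𝔭 𝔭′ ψ = P(ψ(𝔭))·P(ψ(𝔭′)⁻¹)` and `(ψ∘g)⁻¹(𝔭) = ψ(𝔭′)⁻¹`, `((ψ∘g)⁻¹(𝔭′))⁻¹ = ψ(𝔭)`.
[cite: CastellaWan2023, §2.4 Thm. 2.11 (arXiv:1607.02019)] -/
theorem toricEulerFactor_reflected (p : ℕ) (f : CuspForm (Gamma0 N) 2) {𝔭 𝔭' : HeightOneSpectrum (𝓞 K)}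
    (g : K ≃ₐ[ℚ] K) (hg : g • 𝔭 = 𝔭') (hg' : g • 𝔭' = 𝔭) {ψ : HeckeCharacter K}
    (h𝔭 : ψ.IsUnramifiedAt 𝔭) (h𝔭' : ψ.IsUnramifiedAt 𝔭') :
    toricEulerFactor p f 𝔭 𝔭' (HeckeCharacter.galConj g ψ)⁻¹ = toricEulerFactor p f 𝔭 𝔭' ψ := by
  have hu : (HeckeCharacter.galConj g ψ).IsUnramifiedAt 𝔭 :=
    (HeckeCharacter.isUnramifiedAt_galConj_iff g ψ 𝔭).mpr (hg ▸ h𝔭')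
  have hu' : (HeckeCharacter.galConj g ψ).IsUnramifiedAt 𝔭' :=
    (HeckeCharacter.isUnramifiedAt_galConj_iff g ψ 𝔭').mpr (hg' ▸ h𝔭)
  have h1 : heckeValueExtZero (HeckeCharacter.galConj g ψ)⁻¹ 𝔭 = (heckeValueExtZero ψ 𝔭')⁻¹ := by
    rw [heckeValueExtZero_of_isUnramifiedAt hu.inv', HeckeCharacter.valueAtUniformizer_inv',
      HeckeCharacter.valueAtUniformizer_galConj_of_isUnramifiedAt g ψ 𝔭 (hg ▸ h𝔭'), hg, heckeValueExtZero_of_isUnramifiedAt h𝔭']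
  have h2 : heckeValueExtZero (HeckeCharacter.galConj g ψ)⁻¹ 𝔭' = (heckeValueExtZero ψ 𝔭)⁻¹ := by
    rw [heckeValueExtZero_of_isUnramifiedAt hu'.inv', HeckeCharacter.valueAtUniformizer_inv',
      HeckeCharacter.valueAtUniformizer_galConj_of_isUnramifiedAt g ψ 𝔭' (hg' ▸ h𝔭), hg', heckeValueExtZero_of_isUnramifiedAt h𝔭]
  rw [toricEulerFactor, toricEulerFactor, h1, h2, inv_inv, mul_comm]

/-! ## §3 From the `Λ`-identity at `s = 1` to the display clause -/

/-- `(2π)^{−n}` as a complex power with natural exponent: `(2π : ℂ)^(−(n : ℂ)) = ((2π)^n)⁻¹`. [folklore] -/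
theorem twoPi_cpow_neg_natCast (n : ℕ) : (2 * Real.pi : ℂ) ^ (-(n : ℂ)) = ((2 * Real.pi : ℂ) ^ n)⁻¹ := by
  rw [Complex.cpow_neg, Complex.cpow_natCast]

/-- `(2π : ℂ)^(−((n : ℂ) + 1)) = ((2π)^(n+1))⁻¹`. [folklore] -/
theorem twoPi_cpow_neg_natCast_add_one (n : ℕ) : (2 * Real.pi : ℂ) ^ (-((n : ℂ) + 1)) = ((2 * Real.pi : ℂ) ^ (n + 1))⁻¹ := by
  rw [show ((n : ℂ) + 1) = ((n + 1 : ℕ) : ℂ) by push_cast; ring, twoPi_cpow_neg_natCast]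

/-- A positive natural base: `(M : ℂ)^((a : ℂ) − b) = M^a / M^b`. [folklore] -/
theorem natCast_cpow_natCast_sub {M : ℕ} (hM : M ≠ 0) (a b : ℕ) :
    (M : ℂ) ^ ((a : ℂ) - b) = (M : ℂ) ^ a / (M : ℂ) ^ b := by
  have hM' : (M : ℂ) ≠ 0 := by exact_mod_cast hM
  rw [Complex.cpow_sub _ _ hM', Complex.cpow_natCast, Complex.cpow_natCast]

/-- **DISPLAY CURRENCY.** Let `M ≥ 1` (`M = N·|d_K|`) and suppose the `Λ`-identity at `s = 1`
`Γ_ℂ(b)Γ_ℂ(b+1)·x = M^{a−b}·Γ_ℂ(a)Γ_ℂ(a+1)·y` (`Γ_ℂ(z) = 2(2π)^{−z}Γ(z)`) between the continued values `x = L(f/K,ψ,1)` and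
`y = L(f/K,ψ⁻¹,1)`. Then with `κ := M/4`: `κ^a · (Γ(a)Γ(a+1)·E·y/(π^{2a+1}·Ω^{2(b+a)})) = κ^b · (Γ(b)Γ(b+1)·E·x/(π^{2b+1}·Ω^{2(a+b)}))` —
i.e. `κ^a·V(b, a; y) = κ^b·V(a, b; x)` for `V = toricInterpolationValue` with a common Euler factor `E` and period `Ω`. Pure bookkeeping of
the powers of `2` and `π`. [cite: Tate1979, (3.1)] [cite: CastellaWan2023, §2.4 Thm. 2.11 (arXiv:1607.02019)] -/
theorem display_identity_of_lambda_identity {M : ℕ} (hM : M ≠ 0) {a b : ℕ} (x y E Ω : ℂ)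
    (h : (2 * (2 * Real.pi : ℂ) ^ (-(b : ℂ)) * Complex.Gamma b) *
          (2 * (2 * Real.pi : ℂ) ^ (-((b : ℂ) + 1)) * Complex.Gamma (b + 1)) * x =
        (M : ℂ) ^ ((a : ℂ) - b) *
          ((2 * (2 * Real.pi : ℂ) ^ (-(a : ℂ)) * Complex.Gamma a) *
            (2 * (2 * Real.pi : ℂ) ^ (-((a : ℂ) + 1)) * Complex.Gamma (a + 1)) * y)) :
    ((M : ℂ) / 4) ^ a *
        (Complex.Gamma a * Complex.Gamma (a + 1) * E * y / ((Real.pi : ℂ) ^ (2 * a + 1) * Ω ^ (2 * (b + a)))) =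
      ((M : ℂ) / 4) ^ b *
        (Complex.Gamma b * Complex.Gamma (b + 1) * E * x / ((Real.pi : ℂ) ^ (2 * b + 1) * Ω ^ (2 * (a + b)))) := by
  have hπ : (Real.pi : ℂ) ≠ 0 := by exact_mod_cast Real.pi_ne_zero
  have h2π : (2 * Real.pi : ℂ) ≠ 0 := mul_ne_zero two_ne_zero hπ
  have hM' : (M : ℂ) ≠ 0 := by exact_mod_cast hM
  set P : ℂ := Complex.Gamma a * Complex.Gamma (a + 1) with hP
  set Q : ℂ := Complex.Gamma b * Complex.Gamma (b + 1) with hQdef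
  -- the hypothesis with natural powers
  rw [twoPi_cpow_neg_natCast, twoPi_cpow_neg_natCast_add_one, twoPi_cpow_neg_natCast, twoPi_cpow_neg_natCast_add_one,
    natCast_cpow_natCast_sub hM] at h
  -- cleared denominators: `Q·x·M^b·(2π)^{2a+1} = P·y·M^a·(2π)^{2b+1}`
  have hden : (M : ℂ) ^ b * (2 * Real.pi : ℂ) ^ (2 * a + 1) ≠ 0 := mul_ne_zero (pow_ne_zero _ hM') (pow_ne_zero _ h2π)
  have hQ : Q * x = P * y * (M : ℂ) ^ a * (2 * Real.pi : ℂ) ^ (2 * b + 1) / ((M : ℂ) ^ b * (2 * Real.pi : ℂ) ^ (2 * a + 1)) := by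
    have e1 : (2 * ((2 * Real.pi : ℂ) ^ b)⁻¹ * Complex.Gamma b) * (2 * ((2 * Real.pi : ℂ) ^ (b + 1))⁻¹ * Complex.Gamma (b + 1)) * x =
        4 * (Q * x) / (2 * Real.pi : ℂ) ^ (2 * b + 1) := by
      rw [hQdef]; field_simp; ring
    have e2 : (M : ℂ) ^ a / (M : ℂ) ^ b *
          ((2 * ((2 * Real.pi : ℂ) ^ a)⁻¹ * Complex.Gamma a) * (2 * ((2 * Real.pi : ℂ) ^ (a + 1))⁻¹ * Complex.Gamma (a + 1)) * y) =
        4 * (P * y * (M : ℂ) ^ a) / ((M : ℂ) ^ b * (2 * Real.pi : ℂ) ^ (2 * a + 1)) := by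
      rw [hP]; field_simp; ring
    rw [e1, e2] at h
    rw [eq_div_iff hden]
    have h4 : (4 : ℂ) ≠ 0 := by norm_num
    field_simp at h
    linear_combination h
  -- the display identity: trivial when the period power vanishes
  rw [add_comm b a]
  by_cases hΩ : Ω ^ (2 * (a + b)) = 0
  · simp [hΩ]
  have h4a : ((M : ℂ) / 4) ^ a = (M : ℂ) ^ a / 2 ^ (2 * a) := by rw [div_pow, pow_mul]; norm_num
  have h4b : ((M : ℂ) / 4) ^ b = (M : ℂ) ^ b / 2 ^ (2 * b) := by rw [div_pow, pow_mul]; norm_num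
  have key : ((M : ℂ) / 4) ^ a * P * y * (Real.pi : ℂ) ^ (2 * b + 1) =
      ((M : ℂ) / 4) ^ b * (Real.pi : ℂ) ^ (2 * a + 1) * (Q * x) := by
    rw [hQ, h4a, h4b]
    field_simp
    ring
  have hDa : (Real.pi : ℂ) ^ (2 * a + 1) * Ω ^ (2 * (a + b)) ≠ 0 := mul_ne_zero (pow_ne_zero _ hπ) hΩ
  have hDb : (Real.pi : ℂ) ^ (2 * b + 1) * Ω ^ (2 * (a + b)) ≠ 0 := mul_ne_zero (pow_ne_zero _ hπ) hΩ
  rw [mul_div_assoc', mul_div_assoc', div_eq_div_iff hDa hDb]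
  calc ((M : ℂ) / 4) ^ a * (P * E * y) * ((Real.pi : ℂ) ^ (2 * b + 1) * Ω ^ (2 * (a + b)))
      = E * Ω ^ (2 * (a + b)) * (((M : ℂ) / 4) ^ a * P * y * (Real.pi : ℂ) ^ (2 * b + 1)) := by ring
    _ = E * Ω ^ (2 * (a + b)) * (((M : ℂ) / 4) ^ b * (Real.pi : ℂ) ^ (2 * a + 1) * (Q * x)) := by rw [key]
    _ = ((M : ℂ) / 4) ^ b * (Q * E * x) * ((Real.pi : ℂ) ^ (2 * a + 1) * Ω ^ (2 * (a + b))) := by ring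

/-! ## §4 Assembly: the display clause `hFE` of the v8.3 certificate from the `Λ`-identity at `s = 1` -/

/-- **THE DISPLAY FUNCTIONAL EQUATION from the `Λ`-identity at `s = 1`.** Let `g ∈ Aut(K/ℚ)` swap the two places `𝔭, 𝔭′` above `p`, `ψ`
be unramified everywhere, `L′` an entire continuation of `L(f/K, ψ⁻¹, s)` and `L″` one of `L(f/K, (ψ∘g)⁻¹, s)` from a common half-plane, and
suppose the `Λ`-identity at `s = 1`: `Γ_ℂ(b)Γ_ℂ(b+1)·L(1) = (N·|d_K|)^{a−b}·Γ_ℂ(a)Γ_ℂ(a+1)·L′(1)` (the conclusion of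
`jacquet1972_functionalEquation_rankinSelbergHecke_cone.at_one`). Then, with `κ := N·|d_K|/4`,
`κ^a · V(p,f,𝔭,𝔭′; (ψ∘g)⁻¹; b, a; L″(1)) = κ^b · V(p,f,𝔭,𝔭′; ψ; a, b; L(1))` (`V = toricInterpolationValue`) — literally the clause `hFE` of
`…RationalSplitIMCInclusionAtThreeClosedModuloV83` with `κ N d := N·|d|/4`. [cite: Jacquet1972, §19 Thm. 19.14] [cite: Li1979, Thm. 2.2]
[cite: Tate1979, (3.1)] [cite: CastellaWan2023, §2.4 Thm. 2.11 (arXiv:1607.02019)] -/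
theorem displayFE_of_lambdaFE_at_one {p : ℕ} [NeZero N] (f : CuspForm (Gamma0 N) 2) {𝔭 𝔭' : HeightOneSpectrum (𝓞 K)}
    (g : K ≃ₐ[ℚ] K) (hg : g • 𝔭 = 𝔭') (hg' : g • 𝔭' = 𝔭) {ψ : HeckeCharacter K}
    (hunr : ∀ w : HeightOneSpectrum (𝓞 K), ψ.IsUnramifiedAt w) {a b : ℕ} (ΩK : ℂ) {L L' L'' : ℂ → ℂ} {c : ℝ}
    (hL' : Differentiable ℂ L') (hL'e : ∀ s : ℂ, c < s.re → L' s = rankinSelbergEulerProductHecke f ψ⁻¹ s)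
    (hL'' : Differentiable ℂ L'')
    (hL''e : ∀ s : ℂ, c < s.re → L'' s = rankinSelbergEulerProductHecke f (HeckeCharacter.galConj g ψ)⁻¹ s)
    (hFE1 : (2 * (2 * Real.pi : ℂ) ^ (-(b : ℂ)) * Complex.Gamma b) *
          (2 * (2 * Real.pi : ℂ) ^ (-((b : ℂ) + 1)) * Complex.Gamma (b + 1)) * L 1 =
        ((N : ℂ) * ((NumberField.discr K).natAbs : ℂ)) ^ ((a : ℂ) - b) *
          ((2 * (2 * Real.pi : ℂ) ^ (-(a : ℂ)) * Complex.Gamma a) *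
            (2 * (2 * Real.pi : ℂ) ^ (-((a : ℂ) + 1)) * Complex.Gamma (a + 1)) * L' 1)) :
    ((N : ℂ) * ((NumberField.discr K).natAbs : ℂ) / 4) ^ a *
        toricInterpolationValue p f 𝔭 𝔭' (HeckeCharacter.galConj g ψ)⁻¹ b a ΩK (L'' 1) =
      ((N : ℂ) * ((NumberField.discr K).natAbs : ℂ) / 4) ^ b * toricInterpolationValue p f 𝔭 𝔭' ψ a b ΩK (L 1) := by
  have hM : N * (NumberField.discr K).natAbs ≠ 0 :=
    mul_ne_zero (NeZero.ne N) (Int.natAbs_ne_zero.mpr (NumberField.discr_ne_zero K))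
  have hcast : ((N : ℂ) * ((NumberField.discr K).natAbs : ℂ)) = ((N * (NumberField.discr K).natAbs : ℕ) : ℂ) := by push_cast; ring
  rw [toricInterpolationValue, toricInterpolationValue, toricEulerFactor_reflected p f g hg hg' (hunr 𝔭) (hunr 𝔭'),
    continuation_reflected_eq g hL' hL'e hL'' hL''e 1, hcast]
  rw [hcast] at hFE1
  exact display_identity_of_lambda_identity hM (L 1) (L' 1) (toricEulerFactor p f 𝔭 𝔭' ψ) ΩK hFE1

end Summit.BirchSwinnertonDyer.BirchSwinnertonDyer.Theorems.UniversalToricDescentThinComb.DisplayFunctionalEquation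

end
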